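import Mathlib
import Literature.Analysis.FluidPDE.CheskidovFriedlander2009.EnergyInequality
import HarnessLib

/-!
# Cheskidov–Friedlander 2009, §4: the time-averaged dissipation — Thm. 4.1 (inviscid anomalous
# dissipation rate) proved modulo the inviscid attractor, and the upper half of Thm. 4.2 proved
# modulo the viscous attractor

Cheskidov–Friedlander, Physica D 238 (2009) 783–787 = arXiv:0810.3718v1, §4 pp. 9–10. Two
conditional theorems over the vocabulary of `VanishingViscosityLimit.lean`, each reducing a
printed statement to the corresponding ATTRACTOR fact and nothing else:

* `CheskidovFriedlander2009_thm41_of_thm44` — **Thm. 4.1** p. 9 ("Let `a⁰(t)` be a solution to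
  the inviscid dyadic model on `[0,∞)`. Then `lim_{T→∞} T⁻¹∫₀ᵀ dε_{a⁰}(t) =: ε_d > 0`", where
  `ε_{a⁰} = (a⁰(t),f) − ½ d/dt|a⁰(t)|²`, "proved in [CFP]"), at `c = 5/2` — the case the cited
  source (Cheskidov–Friedlander–Pavlović 2010) treats — DERIVED from
  `CheskidovFriedlanderPavlovic2010_thm44` (the inviscid exponential attractor): the Cesàro mean
  `T⁻¹[∫₀ᵀ f₀a₀ − ½(|a(T)|² − |a(0)|²)]` of the anomalous dissipation tends to
  `(α⁰,f) = f₀α⁰₀ = ε_d` because `a(t) → α⁰` in `ℓ²` (so `a₀(t) → α⁰₀` and `|a(t)|²` stays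
  bounded). (`∫₀ᵀ dε_{a⁰}` is transcribed by that bracket: the distributional derivative of the
  bounded function `|a⁰|²` integrates to its increment up to the atoms of `ε_{a⁰}`, which are
  `o(T)`.)
* `CheskidovFriedlander2009_thm42_upper_of_globalAttractor` — the first half of the proof of **Thm. 4.2**
  (p. 9: "Due to the energy inequality … `limsup_{T→∞} T⁻¹∫₀ᵀ ν‖a^ν‖²_{H¹} ≤ lim T⁻¹∫₀ᵀ(a^ν,f) =
  (α^ν,f)`"), DERIVED from `CheskidovFriedlander2009_globalAttractor` (Thm. 3.4 in its faithful form, non-negative fixed point) (the viscous attractor) and the proved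
  energy inequality (`IsSolution.meanDissipation_le`): for every fixed point `α` with non-negative
  entries and every solution with non-negative datum, `T⁻¹∫₀ᵀ ν‖a‖²_{H¹} ≤ f₀α₀ + δ` eventually,
  for every `δ > 0`.

The remaining half of Thm. 4.2 (`liminf ≥ ν‖α^ν‖²_{H¹} = (α^ν,f)`) and the limit `ν → 0`
(Lemma 2.3) need the existence and decay of the viscous fixed point (op. cit. §2, "standard
Navier–Stokes techniques"), which the tree does not yet have; they are not attempted here.
Auxiliary: a Cesàro lemma for continuous functions with a limit at `+∞` (private). No new
definitions, no new facts.
-/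

noncomputable section

open Set MeasureTheory Filter
open scoped ENNReal BigOperators Topology

namespace Literature.Analysis.FluidPDE.CheskidovFriedlander2009

/-! ### A Cesàro lemma -/

/-- Cesàro means of a function continuous on `[0,∞)` with a limit `L` at `+∞` tend to `L`.
[folklore] -/
private theorem tendsto_cesaro_of_tendsto {g : ℝ → ℝ} {L : ℝ} (hg : ContinuousOn g (Ici 0))
    (hlim : Tendsto g atTop (𝓝 L)) :
    Tendsto (fun T : ℝ => T⁻¹ * ∫ t in (0 : ℝ)..T, g t) atTop (𝓝 L) := by
  rw [Metric.tendsto_atTop]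
  intro ε hε
  obtain ⟨T₀, hT₀⟩ := Metric.tendsto_atTop.1 hlim (ε / 2) (half_pos hε)
  set T₁ : ℝ := max T₀ 1 with hT₁
  have hT₁0 : 0 < T₁ := lt_of_lt_of_le one_pos (le_max_right _ _)
  have hint : ∀ u v : ℝ, 0 ≤ u → u ≤ v → IntervalIntegrable (fun t => g t - L) volume u v :=
    fun u v hu huv => ((hg.sub continuousOn_const).mono
      (fun t ht => hu.trans ht.1)).intervalIntegrable_of_Icc huv
  set C₀ : ℝ := |∫ t in (0 : ℝ)..T₁, (g t - L)| with hC₀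
  refine ⟨max T₁ (2 * C₀ / ε + 1), fun T hT => ?_⟩
  have hTT₁ : T₁ ≤ T := (le_max_left _ _).trans hT
  have hT0 : 0 < T := hT₁0.trans_le hTT₁
  have hTC : 2 * C₀ / ε < T := by linarith [(le_max_right T₁ (2 * C₀ / ε + 1)).trans hT]
  -- rewrite the Cesàro mean minus `L` as the mean of `g - L`
  have hgi : IntervalIntegrable g volume 0 T :=
    (hg.mono fun t ht => ht.1).intervalIntegrable_of_Icc hT0.le
  have hmean : T⁻¹ * (∫ t in (0 : ℝ)..T, g t) - L = T⁻¹ * ∫ t in (0 : ℝ)..T, (g t - L) := by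
    rw [intervalIntegral.integral_sub hgi intervalIntegrable_const, intervalIntegral.integral_const,
      sub_zero, smul_eq_mul]
    field_simp
  rw [Real.dist_eq, hmean]
  -- split at `T₁`
  have hsplit : ∫ t in (0 : ℝ)..T, (g t - L) =
      (∫ t in (0 : ℝ)..T₁, (g t - L)) + ∫ t in T₁..T, (g t - L) :=
    (intervalIntegral.integral_add_adjacent_intervals (hint 0 T₁ le_rfl hT₁0.le)
      (hint T₁ T hT₁0.le hTT₁)).symm
  have htail : |∫ t in T₁..T, (g t - L)| ≤ ε / 2 * |T - T₁| := by
    have h := intervalIntegral.norm_integral_le_of_norm_le_const (a := T₁) (b := T)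
      (f := fun t => g t - L) (C := ε / 2) fun t ht => ?_
    · simpa [Real.norm_eq_abs] using h
    · rw [uIoc_of_le hTT₁] at ht
      have := hT₀ t ((le_max_left _ _).trans ht.1.le)
      rw [Real.dist_eq] at this
      simpa [Real.norm_eq_abs] using this.le
  have habsT : |T - T₁| ≤ T := by
    rw [abs_of_nonneg (by linarith)]
    linarith
  calc |T⁻¹ * ∫ t in (0 : ℝ)..T, (g t - L)|
      = T⁻¹ * |(∫ t in (0 : ℝ)..T₁, (g t - L)) + ∫ t in T₁..T, (g t - L)| := by
        rw [abs_mul, abs_of_pos (inv_pos.mpr hT0), hsplit]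
    _ ≤ T⁻¹ * (C₀ + ε / 2 * T) := by
        refine mul_le_mul_of_nonneg_left ?_ (inv_pos.mpr hT0).le
        calc |(∫ t in (0 : ℝ)..T₁, (g t - L)) + ∫ t in T₁..T, (g t - L)|
            ≤ C₀ + |∫ t in T₁..T, (g t - L)| := abs_add_le _ _
          _ ≤ C₀ + ε / 2 * T := by
              have : ε / 2 * |T - T₁| ≤ ε / 2 * T := mul_le_mul_of_nonneg_left habsT (by linarith)
              linarith
    _ = C₀ / T + ε / 2 := by field_simp
    _ < ε / 2 + ε / 2 := by
        have : C₀ / T < ε / 2 := by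
          rw [div_lt_iff₀ hT0]
          have hC0 : 0 ≤ C₀ := abs_nonneg _
          rw [div_lt_iff₀ hε] at hTC
          linarith
        linarith
    _ = ε := by ring

/-! ### Convergence to a fixed point: consequences for one mode and for the energy -/

/-- Square-summability of a difference of two `ℓ²` sequences. [folklore] -/
private theorem summable_sq_sub {x y : ℕ → ℝ} (hx : Summable fun j => x j ^ 2)
    (hy : Summable fun j => y j ^ 2) : Summable fun j => (x j - y j) ^ 2 := by
  have h2 : ∀ j, (x j - y j) ^ 2 ≤ 2 * x j ^ 2 + 2 * y j ^ 2 := fun j => by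
    nlinarith [sq_nonneg (x j + y j)]
  exact Summable.of_nonneg_of_le (fun j => sq_nonneg _) h2 ((hx.mul_left 2).add (hy.mul_left 2))

/-- One coordinate is controlled by the `ℓ²` distance: `(x_j − y_j)² ≤ |x − y|²`. [folklore] -/
private theorem sq_sub_le_normSq {x y : ℕ → ℝ} (hx : Summable fun j => x j ^ 2)
    (hy : Summable fun j => y j ^ 2) (j : ℕ) :
    (x j - y j) ^ 2 ≤ normSq (fun i => x i - y i) :=
  (summable_sq_sub hx hy).le_tsum j fun _ _ => sq_nonneg _

/-- The energy is controlled by the distance to `y`: `|x|² ≤ 2|x − y|² + 2|y|²`. [folklore] -/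
private theorem normSq_le_two_mul {x y : ℕ → ℝ} (hx : Summable fun j => x j ^ 2)
    (hy : Summable fun j => y j ^ 2) :
    normSq x ≤ 2 * normSq (fun i => x i - y i) + 2 * normSq y := by
  have h2 : ∀ j, x j ^ 2 ≤ 2 * (x j - y j) ^ 2 + 2 * y j ^ 2 := fun j => by
    nlinarith [sq_nonneg (x j - 2 * y j)]
  unfold normSq
  rw [← tsum_mul_left, ← tsum_mul_left, ← ((summable_sq_sub hx hy).mul_left 2).tsum_add
    (hy.mul_left 2)]
  exact hx.tsum_le_tsum h2 (((summable_sq_sub hx hy).mul_left 2).add (hy.mul_left 2))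

/-- If `|a(t) − α|² ≤ D₀e^{−κt}` (`κ > 0`) along a solution, then the first mode converges:
`a₀(t) → α₀`. [cite: CheskidovFriedlander2009, Thm 4.2 p.9–10 (proof)] -/
theorem tendsto_mode_zero_of_exp_decay {c ν : ℝ} {f : ℕ → ℝ} {a : ℕ → ℝ → ℝ} {α : ℕ → ℝ}
    (ha : IsSolution c ν f a) (hα : Summable fun j => α j ^ 2) {D₀ κ : ℝ} (hκ : 0 < κ)
    (hdec : ∀ t, 0 ≤ t → normSq (fun j => a j t - α j) ≤ D₀ * Real.exp (-(κ * t))) :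
    Tendsto (fun t => a 0 t) atTop (𝓝 (α 0)) := by
  -- `(a₀(t) − α₀)² ≤ D₀ e^{−κt} → 0`
  have hexp : Tendsto (fun t => D₀ * Real.exp (-(κ * t))) atTop (𝓝 0) := by
    have h1 : Tendsto (fun t => Real.exp (-(κ * t))) atTop (𝓝 0) := by
      have := Real.tendsto_exp_neg_atTop_nhds_zero.comp (tendsto_id.const_mul_atTop hκ)
      simpa [Function.comp_def] using this
    simpa using h1.const_mul D₀
  have hsq : Tendsto (fun t => (a 0 t - α 0) ^ 2) atTop (𝓝 0) := by
    refine tendsto_of_tendsto_of_tendsto_of_le_of_le' tendsto_const_nhds hexp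
      (Eventually.of_forall fun t => sq_nonneg _) ?_
    filter_upwards [eventually_ge_atTop (0 : ℝ)] with t ht
    exact (sq_sub_le_normSq (ha.summable_sq t ht) hα 0).trans (hdec t ht)
  have habs : Tendsto (fun t => |a 0 t - α 0|) atTop (𝓝 0) := by
    have h := hsq.sqrt
    simpa [Real.sqrt_sq_eq_abs] using h
  have h0 : Tendsto (fun t => a 0 t - α 0) atTop (𝓝 0) :=
    (tendsto_zero_iff_abs_tendsto_zero _).mpr habs
  simpa using h0.add_const (α 0)

/-! ### Thm. 4.1 modulo the inviscid attractor -/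

/-- **Cheskidov–Friedlander 2009, Theorem 4.1 (the inviscid anomalous dissipation rate), at
`c = 5/2`, derived from the inviscid attractor `CheskidovFriedlanderPavlovic2010_thm44`**: for
every solution `a` of the inviscid model (force `f₀ > 0` on the first shell) with non-negative
`ℓ²` datum, the time average of the anomalous dissipation
`T⁻¹[∫₀ᵀ (a(t),f)dt − ½(|a(T)|² − |a(0)|²)]` tends to `ε_d = f₀α⁰₀` as `T → ∞`
(p. 9: "`lim_{T→∞} T⁻¹∫₀ᵀ dε_{a⁰}(t) =: ε_d > 0`"; positivity is `epsilonD_pos`).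
[cite: CheskidovFriedlander2009, Thm 4.1 p.9] [cite: CheskidovFriedlanderPavlovic2010, Thm 4.4 p.10 and §6 p.14–15] -/
theorem CheskidovFriedlander2009_thm41_of_thm44 (h44 : CheskidovFriedlanderPavlovic2010_thm44)
    {f₀ : ℝ} (hf : 0 < f₀) {a : ℕ → ℝ → ℝ} (ha : IsSolution (5 / 2) 0 (force f₀) a)
    (h0 : ∀ j, 0 ≤ a j 0) :
    Tendsto (fun T : ℝ => T⁻¹ * ((∫ t in (0 : ℝ)..T, f₀ * a 0 t)
        - (normSq (fun j => a j T) - normSq (fun j => a j 0)) / 2)) atTop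
      (𝓝 (epsilonD (5 / 2) f₀)) := by
  obtain ⟨β, hβ, hatt⟩ := h44
  set α : ℕ → ℝ := inviscidFixedPoint (5 / 2) f₀ with hαdef
  have hαfix := isFixedPoint_inviscidFixedPoint (c := 5 / 2) (f₀ := f₀) (by norm_num) hf.le
  have hαsum : Summable fun j => α j ^ 2 := hαfix.1
  set κ : ℝ := β * Real.sqrt ((2 : ℝ) ^ (5 / 6 : ℝ) * f₀) with hκdef
  have hκ : 0 < κ := by
    have : 0 < (2 : ℝ) ^ (5 / 6 : ℝ) * f₀ := mul_pos (Real.rpow_pos_of_pos two_pos _) hf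
    exact mul_pos hβ (Real.sqrt_pos.mpr this)
  set D₀ : ℝ := normSq (fun j => a j 0 - α j) with hD₀
  have hdec : ∀ t, 0 ≤ t → normSq (fun j => a j t - α j) ≤ D₀ * Real.exp (-(κ * t)) := by
    intro t ht
    have := hatt f₀ hf a ha h0 t ht
    simpa [hαdef, hκdef, hD₀, mul_assoc] using this
  -- (1) the mean of `f₀ a₀` tends to `f₀ α₀ = ε_d`
  have hmode := tendsto_mode_zero_of_exp_decay ha hαsum hκ hdec
  have hces : Tendsto (fun T : ℝ => T⁻¹ * ∫ t in (0 : ℝ)..T, f₀ * a 0 t) atTop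
      (𝓝 (epsilonD (5 / 2) f₀)) := by
    have hcont : ContinuousOn (fun t => f₀ * a 0 t) (Ici 0) :=
      continuousOn_const.mul (ha.continuousOn 0)
    have := tendsto_cesaro_of_tendsto hcont (hmode.const_mul f₀)
    simpa [epsilonD, hαdef] using this
  -- (2) the energy increment is bounded, so its mean tends to `0`
  have hD₀nn : 0 ≤ D₀ := tsum_nonneg fun j => sq_nonneg _
  have hbound : ∀ T, 0 ≤ T → |normSq (fun j => a j T) - normSq (fun j => a j 0)| ≤
      2 * D₀ + 2 * normSq α + normSq (fun j => a j 0) := by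
    intro T hT
    have hET : 0 ≤ normSq (fun j => a j T) := tsum_nonneg fun j => sq_nonneg _
    have hE0 : 0 ≤ normSq (fun j => a j 0) := tsum_nonneg fun j => sq_nonneg _
    have h1 := normSq_le_two_mul (ha.summable_sq T hT) hαsum
    have h2 : normSq (fun j => a j T - α j) ≤ D₀ := by
      refine (hdec T hT).trans ?_
      have : Real.exp (-(κ * T)) ≤ 1 := Real.exp_le_one_iff.mpr (by nlinarith)
      nlinarith
    rw [abs_le]
    constructor <;> nlinarith
  have hincr : Tendsto (fun T : ℝ => T⁻¹ * ((normSq (fun j => a j T) - normSq (fun j => a j 0)) / 2))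
      atTop (𝓝 0) := by
    set M : ℝ := 2 * D₀ + 2 * normSq α + normSq (fun j => a j 0) with hM
    have hM0 : 0 ≤ M := by
      have : 0 ≤ normSq α := tsum_nonneg fun j => sq_nonneg _
      have : 0 ≤ normSq (fun j => a j 0) := tsum_nonneg fun j => sq_nonneg _
      positivity
    have hinv : Tendsto (fun T : ℝ => M / 2 * T⁻¹) atTop (𝓝 0) := by
      simpa using tendsto_inv_atTop_zero.const_mul (M / 2)
    refine squeeze_zero_norm' ?_ hinv
    filter_upwards [eventually_gt_atTop (0 : ℝ)] with T hT
    rw [Real.norm_eq_abs, abs_mul, abs_of_pos (inv_pos.mpr hT), abs_div, abs_two]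
    have := hbound T hT.le
    have hTi : 0 ≤ T⁻¹ := (inv_pos.mpr hT).le
    calc T⁻¹ * (|normSq (fun j => a j T) - normSq (fun j => a j 0)| / 2)
        ≤ T⁻¹ * (M / 2) := mul_le_mul_of_nonneg_left (by linarith) hTi
      _ = M / 2 * T⁻¹ := by ring
  -- combine
  have := hces.sub hincr
  simpa [mul_sub] using this

/-! ### Thm. 4.2, upper half, modulo the viscous attractor -/

/-- **Cheskidov–Friedlander 2009, proof of Thm. 4.2, first half** (p. 9: "Due to the energy
inequality … `limsup_{T→∞} T⁻¹∫₀ᵀ ν‖a^ν(t)‖²_{H¹}dt ≤ lim_{T→∞} T⁻¹∫₀ᵀ (a^ν(s),f)ds = (α^ν,f)`"),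
derived from the viscous attractor `CheskidovFriedlander2009_globalAttractor` and the proved energy
inequality: for `c ∈ (3/2, 5/2]`, `ν > 0`, `f₀ > 0`, every `ℓ²` fixed point `α` and every solution
`a` with non-negative datum, the mean dissipation satisfies `T⁻¹∫₀ᵀ ν‖a‖²_{H¹} ≤ f₀α₀ + δ` for all
large `T`, whatever `δ > 0`. [cite: CheskidovFriedlander2009, Thm 4.2 p.9 (proof)] -/
theorem CheskidovFriedlander2009_thm42_upper_of_globalAttractor (h34 : CheskidovFriedlander2009_globalAttractor)
    {c ν f₀ : ℝ} (hc : 3 / 2 < c) (hc' : c ≤ 5 / 2) (hν : 0 < ν) (hf : 0 < f₀) {α : ℕ → ℝ}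
    (hα : IsFixedPoint c ν (force f₀) α) (hαnn : ∀ j, 0 ≤ α j) {a : ℕ → ℝ → ℝ}
    (ha : IsSolution c ν (force f₀) a) (h0 : ∀ j, 0 ≤ a j 0) {δ : ℝ} (hδ : 0 < δ) :
    ∀ᶠ T in atTop, meanDissipation ν a T ≤ f₀ * α 0 + δ := by
  obtain ⟨γ, hγ0, -, hatt⟩ := h34 c hc hc'
  have hc0 : c ≠ 0 := by linarith
  set κ : ℝ := 2 * γ * ν with hκdef
  have hκ : 0 < κ := by positivity
  set D₀ : ℝ := normSq (fun j => a j 0 - α j) with hD₀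
  have hdec : ∀ t, 0 ≤ t → normSq (fun j => a j t - α j) ≤ D₀ * Real.exp (-(κ * t)) := by
    intro t ht
    have := hatt ν f₀ hν hf α hα hαnn a ha h0 t ht
    simpa [hκdef, hD₀, mul_assoc] using this
  -- the mean of `a₀` tends to `α₀`, and `|a(0)|²/(2T) → 0`
  have hmode := tendsto_mode_zero_of_exp_decay ha hα.1 hκ hdec
  have hces : Tendsto (fun T : ℝ => T⁻¹ * ∫ t in (0 : ℝ)..T, a 0 t) atTop (𝓝 (α 0)) :=
    tendsto_cesaro_of_tendsto (ha.continuousOn 0) hmode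
  have hinit : Tendsto (fun T : ℝ => (2 * T)⁻¹ * normSq (fun j => a j 0)) atTop (𝓝 0) := by
    have h := tendsto_inv_atTop_zero.comp (tendsto_id.const_mul_atTop (by norm_num : (0:ℝ) < 2))
    simpa [Function.comp_def] using h.mul_const (normSq (fun j => a j 0))
  have hrhs : Tendsto (fun T : ℝ => (2 * T)⁻¹ * normSq (fun j => a j 0)
      + f₀ * (T⁻¹ * ∫ t in (0 : ℝ)..T, a 0 t)) atTop (𝓝 (0 + f₀ * α 0)) :=
    hinit.add (hces.const_mul f₀)
  rw [zero_add] at hrhs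
  have hev : ∀ᶠ T in atTop, (2 * T)⁻¹ * normSq (fun j => a j 0)
      + f₀ * (T⁻¹ * ∫ t in (0 : ℝ)..T, a 0 t) < f₀ * α 0 + δ :=
    hrhs.eventually (gt_mem_nhds (by linarith))
  filter_upwards [hev, eventually_gt_atTop (0 : ℝ)] with T hT hT0
  exact ((ha.meanDissipation_le hc0 hν hf.le h0 hT0).trans hT.le)

end Literature.Analysis.FluidPDE.CheskidovFriedlander2009

end
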